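import Literature.NumberTheory.Automorphic.ShimuraCurveLocalUnitNorms
import Literature.NumberTheory.Automorphic.QuaternionPositiveNorms
import Literature.NumberTheory.Automorphic.QuaternionNormOneLatticePoints
import Literature.NumberTheory.Automorphic.QuaternionAlgebraIntegralModel
import Literature.NumberTheory.Automorphic.QuaternionIdealLocallyPrincipal
import Literature.NumberTheory.Automorphic.QuaternionSubidealCount
import Literature.NumberTheory.Automorphic.ShimuraCurveVolumeSplitCase
import Literature.NumberTheory.Automorphic.ShimuraCurveFiniteVolume
import Literature.NumberTheory.Automorphic.BrandtDataRingEquiv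
import Literature.NumberTheory.Automorphic.BrandtModuleChains
import HarnessLib

/-!
# Eichler's theorem for `X₀^D(M)`: the invertible ideals of the Eichler order are principal,
# generated by elements of positive norm

Topic `NumberTheory/Automorphic`; theorems only (no definition, no named fact, no instance).
For a Shimura curve datum `X : ShimuraCurveData D M` with `D > 1`, `M ≥ 1` (`B = X.B` the
indefinite division quaternion algebra of discriminant `D`, `O = X.O` an Eichler order of level
`M`), every invertible (= locally principal) integral right `O`-ideal `I ⊆ O` is principal,
`I = β O`, with a generator `β ∈ O` of *positive* reduced norm
(`ShimuraCurveData.exists_eq_units_smul_of_pos`) — Eichler's theorem "class number one for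
Eichler orders in indefinite quaternion algebras over `ℚ`" in the refined form with the sign of
the norm prescribed (Vignéras, LNM 800, Ch. III §5 Cor. 5.7 with `K = ℚ`, `h⁺(ℤ) = 1`).

Proof (Eichler–Kneser): let `[O : I] = n²` (the local indices are `p^{2k_p}`,
`exists_relIndex_units_smul_localAt_eq_pow`). Pick `β₀ ∈ B` with `nrd β₀ = n` (norm theorem,
`exists_reducedNorm_eq_of_pos`) and put `L = β₀⁻¹ I`. At each prime `p`, `I₍ₚ₎ = α_p O₍ₚ₎`
(Kaplansky, `exists_localAt_eq_units_smul`) with `v_p(nrd α_p) = v_p(n)`, and there is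
`g ∈ O₍ₚ₎` with `nrd g = (n / nrd α_p)(1 + p⁴ r)`, `r ∈ ℤ₍ₚ₎`
(`exists_mem_localAt_reducedNorm_eq_mul_of_not_dvd` at `p ∤ D`, the norm theorem and the
valuative description of `O₍ₚ₎` at `p ∣ D`); then `z_p = β₀⁻¹ α_p g ∈ L₍ₚ₎` has
`nrd z_p = 1 + 8 d_p`, `|d_p|_p < 1`. By the lattice form of strong approximation
(`QuaternionAlgebra.exists_mem_mul_star_eq_one`, after moving to an integral model
`B ≃ ℍ[ℚ,a,b]`) some `x ∈ L` has `nrd x = 1`; `β = β₀ x ∈ I` has `nrd β = n`, so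
`[O : βO] = n² = [O : I]` and `β O ⊆ I` force `I = β O`.

## References

* M.-F. Vignéras, *Arithmétique des algèbres de quaternions*, LNM 800 (1980), Ch. III §4
  Thm. 4.1, 4.3, §5 Cor. 5.7 [VignerasLNM800].
* J. Voight, *Quaternion Algebras*, GTM 288 (2021), Thm. 28.2.11, Cor. 28.5.5 [Voight2021].
-/

open NumberField IsDedekindDomain
open scoped Pointwise Quaternion

namespace Literature.NumberTheory.Automorphic

/-! ### A `p`-adic estimate -/

/-- `|p⁴ r / 8|_p < 1` for `r ∈ ℤ₍ₚ₎`. [folklore] -/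
theorem padicNorm_pow_four_mul_div_eight_lt_one {p : ℕ} (hp : p.Prime) {r : ℚ}
    (hr : padicNorm p r ≤ 1) : padicNorm p ((p : ℚ) ^ 4 * r / 8) < 1 := by
  haveI : Fact p.Prime := ⟨hp⟩
  have hp0 : (0 : ℚ) < p := by exact_mod_cast hp.pos
  have hpp : padicNorm p ((p : ℚ) ^ 4) = ((p : ℚ) ^ 4)⁻¹ := by
    rw [show ((p : ℚ) ^ 4) = (p : ℚ) * p * p * p by ring, padicNorm.mul, padicNorm.mul, padicNorm.mul,
      padicNorm.padicNorm_p_of_prime]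
    ring
  -- `|8|_p ≥ 1/8`
  have h8 : (8 : ℚ)⁻¹ ≤ padicNorm p 8 := by
    by_cases h2 : p = 2
    · subst h2
      rw [show (8 : ℚ) = (2 : ℕ) * (2 : ℕ) * (2 : ℕ) by norm_num, padicNorm.mul, padicNorm.mul,
        padicNorm.padicNorm_p_of_prime]
      norm_num
    · have h : padicNorm p ((8 : ℕ) : ℚ) = 1 := by
        rw [padicNorm.nat_eq_one_iff]
        intro hdvd
        have : p ∣ 2 ^ 3 := by simpa using hdvd
        exact h2 ((Nat.prime_dvd_prime_iff_eq hp Nat.prime_two).mp (hp.dvd_of_dvd_pow this))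
      rw [show (8 : ℚ) = ((8 : ℕ) : ℚ) by norm_num, h]
      norm_num
  have h8pos : (0 : ℚ) < padicNorm p 8 := lt_of_lt_of_le (by norm_num) h8
  rw [padicNorm.div, padicNorm.mul, hpp, div_lt_one h8pos]
  have hp2 : (2 : ℚ) ≤ p := by exact_mod_cast hp.two_le
  have hp4 : (16 : ℚ) ≤ (p : ℚ) ^ 4 := by
    have h : (2 : ℚ) ^ 4 ≤ (p : ℚ) ^ 4 := pow_le_pow_left₀ (by norm_num) hp2 4
    norm_num at h
    exact h
  calc ((p : ℚ) ^ 4)⁻¹ * padicNorm p r ≤ ((p : ℚ) ^ 4)⁻¹ * 1 :=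
        mul_le_mul_of_nonneg_left hr (inv_nonneg.mpr (by positivity))
    _ ≤ 16⁻¹ := by rw [mul_one]; exact inv_anti₀ (by norm_num) hp4
    _ < 8⁻¹ := by norm_num
    _ ≤ padicNorm p 8 := h8

namespace ShimuraCurveData

variable {D M : ℕ} (X : ShimuraCurveData D M)

/-! ### Eichler's theorem with positive generators -/

/-- **The invertible integral right ideals of the Eichler order of `X₀^D(M)` (`D > 1`) are
principal, generated by an element of positive reduced norm** (Eichler; Vignéras III §5
Cor. 5.7 for `K = ℚ`: `B` indefinite, `h⁺(ℤ) = 1`; proof by Kneser's strong approximation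
theorem as sketched in the module docstring). [cite: VignerasLNM800, Ch. III §5 Cor. 5.7] -/
theorem exists_eq_units_smul_of_pos (hD : 1 < D) (hM : 0 < M) {I : Submodule ℤ X.B}
    (hI : IsInvertibleRightIdeal X.O I) (hIO : I ≤ X.O) :
    ∃ β : (X.B)ˣ, (β : X.B) ∈ X.O ∧ 0 < reducedNorm ℚ X.B β ∧ I = β • X.O := by
  classical
  haveI := X.nontrivial_B
  haveI := X.charZero_B
  haveI : IsAddTorsionFree X.B := isAddTorsionFree_of_charZero_module ℚ X.B
  have hdiv : ∀ x : X.B, x ≠ 0 → IsUnit x := fun x hx => X.isUnit_of_ne_zero hD x hx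
  have hZO := X.isZOrder
  -- Step 1: `[O : I] = n²`
  set m : ℕ := I.toAddSubgroup.relIndex X.O.toAddSubgroup with hm
  have hm0 : m ≠ 0 := relIndex_ne_zero_of_isFullLattice hI.isFullLattice hZO.isFullLattice.1
  have hloc_exp : ∀ p : ℕ, p.Prime → ∃ α : (X.B)ˣ, (α : X.B) ∈ I ∧
      localAt p I = α • localAt p X.O ∧
      ∃ k : ℕ, padicValRat p (reducedNorm ℚ X.B α) = k ∧ m.factorization p = 2 * k := by
    intro p hp
    haveI : Fact p.Prime := ⟨hp⟩
    obtain ⟨α, hαI, hαloc⟩ := hI.exists_localAt_eq_units_smul hdiv hZO p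
    have hαO : (α : X.B) ∈ localAt p X.O := le_localAt p X.O (hIO hαI)
    obtain ⟨k, hk, hidx⟩ := exists_relIndex_units_smul_localAt_eq_pow hZO α hαO
    refine ⟨α, hαI, hαloc, k, hk, ?_⟩
    have h := relIndex_localAt (p := p) X.O I hIO hm0
    rw [hαloc, hidx] at h
    exact (Nat.pow_right_injective hp.two_le h).symm
  set g : ℕ →₀ ℕ := Finsupp.mapRange (fun e => e / 2) (by norm_num) m.factorization with hg
  have hgsupp : ∀ p ∈ g.support, p.Prime := fun p hp =>
    Nat.prime_of_mem_primeFactors (Nat.support_factorization m ▸ Finsupp.support_mapRange hp)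
  set n : ℕ := g.prod (· ^ ·) with hn
  have hnfac : n.factorization = g := Nat.prod_pow_factorization_eq_self hgsupp
  have hn0 : n ≠ 0 := by
    rw [hn, Finsupp.prod]
    exact Finset.prod_ne_zero_iff.mpr fun p hp => pow_ne_zero _ (hgsupp p hp).ne_zero
  have hgp : ∀ p, p.Prime → ∃ k : ℕ, m.factorization p = 2 * k ∧ g p = k := by
    intro p hp
    obtain ⟨-, -, -, k, -, hk2⟩ := hloc_exp p hp
    refine ⟨k, hk2, ?_⟩
    rw [hg, Finsupp.mapRange_apply, hk2]
    omega
  have hn2 : n ^ 2 = m := by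
    refine Nat.eq_of_factorization_eq (pow_ne_zero 2 hn0) hm0 fun p => ?_
    rw [Nat.factorization_pow, Finsupp.smul_apply, hnfac, smul_eq_mul]
    by_cases hp : p.Prime
    · obtain ⟨k, hk2, hgk⟩ := hgp p hp
      rw [hk2, hgk]
    · rw [Nat.factorization_eq_zero_of_not_prime m hp, hg, Finsupp.mapRange_apply,
        Nat.factorization_eq_zero_of_not_prime m hp]
  have hvn : ∀ p, p.Prime → ∃ k : ℕ, m.factorization p = 2 * k ∧ padicValRat p (n : ℚ) = k := by
    intro p hp
    obtain ⟨k, hk2, hgk⟩ := hgp p hp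
    refine ⟨k, hk2, ?_⟩
    rw [padicValRat.of_nat, ← Nat.factorization_def n hp, hnfac, hgk]
  -- Step 2: `β₀` with `nrd β₀ = n`
  have hnpos : (0 : ℚ) < n := by exact_mod_cast Nat.pos_of_ne_zero hn0
  obtain ⟨β₀, hβ₀⟩ := exists_reducedNorm_eq_of_pos hdiv hnpos
  have hβ₀0 : β₀ ≠ 0 := by
    rintro rfl
    rw [reducedNorm_apply_zero] at hβ₀
    exact hnpos.ne hβ₀
  set u₀ : (X.B)ˣ := (hdiv β₀ hβ₀0).unit with hu₀def
  have hu₀ : (u₀ : X.B) = β₀ := (hdiv β₀ hβ₀0).unit_spec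
  -- Step 3: the lattice `L = β₀⁻¹ I` in an integral model `H = ℍ[ℚ,a,b]`
  obtain ⟨a, b, ha, hb, ⟨e⟩⟩ :=
    QuaternionAlgebra.exists_algEquiv_quaternionAlgebra_integers (K := ℚ) (D := X.B)
  have hinjO := FaithfulSMul.algebraMap_injective (𝓞 ℚ) ℚ
  haveI : IsQuaternionAlgebra ℚ ℍ[ℚ,algebraMap (𝓞 ℚ) ℚ a,algebraMap (𝓞 ℚ) ℚ b] :=
    QuaternionAlgebra.isQuaternionAlgebra_holds ((map_ne_zero_iff _ hinjO).mpr ha)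
      ((map_ne_zero_iff _ hinjO).mpr hb)
  set L : Submodule ℤ X.B := u₀⁻¹ • I with hL
  set Λ : Submodule ℤ ℍ[ℚ,algebraMap (𝓞 ℚ) ℚ a,algebraMap (𝓞 ℚ) ℚ b] :=
    L.map (e.toRingEquiv.toAddEquiv.toIntLinearEquiv :
      X.B →ₗ[ℤ] ℍ[ℚ,algebraMap (𝓞 ℚ) ℚ a,algebraMap (𝓞 ℚ) ℚ b]) with hΛ
  have hΛfull : IsFullLattice _ Λ := (hI.isFullLattice.units_smul u₀⁻¹).map_ringEquiv e.toRingEquiv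
  have hdef : ¬ IsTotallyDefinite ℚ ℍ[ℚ,algebraMap (𝓞 ℚ) ℚ a,algebraMap (𝓞 ℚ) ℚ b] := by
    obtain ⟨w⟩ : Nonempty (InfinitePlace ℚ) := inferInstance
    exact fun h => h w (isSplitAtInfinite_of_algHom_real
      (X.ι.comp (e.symm : ℍ[ℚ,algebraMap (𝓞 ℚ) ℚ a,algebraMap (𝓞 ℚ) ℚ b] →ₐ[ℚ] X.B)) w)
  -- Step 4: local norm-`(1 + 8d)` points of `Λ₍ₚ₎`
  have hlocΛ : ∀ p : ℕ, p.Prime → ∃ z ∈ localAt p Λ, ∃ d : ℚ, padicNorm p d < 1 ∧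
      z * star z = algebraMap ℚ _ (1 + 8 * d) := by
    intro p hp
    haveI : Fact p.Prime := ⟨hp⟩
    obtain ⟨α, -, hαloc, k, hk, hk2⟩ := hloc_exp p hp
    obtain ⟨k', hk2', hvnk⟩ := hvn p hp
    have hkk : k' = k := by omega
    subst hkk
    have hα0 : reducedNorm ℚ X.B α ≠ 0 :=
      (isUnit_iff_reducedNorm_ne_zero_holds ℚ X.B (α : X.B)).mp α.isUnit
    set u : ℚ := (n : ℚ) / reducedNorm ℚ X.B α with hu
    have hu0 : u ≠ 0 := div_ne_zero (by exact_mod_cast hn0) hα0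
    have hvu : padicValRat p u = 0 := by
      rw [hu, padicValRat.div (by exact_mod_cast hn0) hα0, hvnk, hk]
      ring
    -- `g ∈ O₍ₚ₎` with `nrd g = u (1 + p⁴ r)`
    obtain ⟨g', hgO, r, hr, hgr⟩ : ∃ g' : X.B, g' ∈ localAt p X.O ∧ ∃ r : ℚ, ¬ p ∣ r.den ∧
        reducedNorm ℚ X.B g' = u * (1 + (p : ℚ) ^ 4 * r) := by
      by_cases hpD : p ∣ D
      · obtain ⟨g', hg'⟩ := exists_reducedNorm_eq_of_exists_neg hdiv (X.exists_reducedNorm_neg hD) hu0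
        refine ⟨g', ?_, 0, by simp [hp.one_lt.ne'], by rw [hg']; ring⟩
        have hT := isUnit_padicTensor_of_dvd X.B X.mem_ramifiedPlaces_iff hpD
        have hEO : IsEichlerOrder X.O M := isEichlerOrder_iff_brandt.mpr X.isEichlerOrder
        obtain ⟨O₁, hO₁, -, hloc1⟩ := hEO.exists_isMaximalZOrder_localAt_eq_of_padic_division hT
        rw [hloc1, hO₁.mem_localAt_iff_of_ramified hdiv hT g', hg', ← Padic.norm_ratCast_le_one_iff,
          Padic.norm_ratCast_eq_zpow hu0, hvu, neg_zero, zpow_zero]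
      · exact X.exists_mem_localAt_reducedNorm_eq_mul_of_not_dvd hD hM hp hpD hu0 hvu 4
    -- `z := β₀⁻¹ α g ∈ L₍ₚ₎` with `nrd z = 1 + p⁴ r`
    set z : X.B := (u₀⁻¹ : (X.B)ˣ) • ((α : (X.B)ˣ) • g') with hz
    have hzL : z ∈ localAt p L := by
      rw [hL, localAt_units_smul, hαloc]
      exact Submodule.smul_mem_pointwise_smul _ _ _ (Submodule.smul_mem_pointwise_smul _ _ _ hgO)
    have hnz : reducedNorm ℚ X.B z = 1 + (p : ℚ) ^ 4 * r := by
      rw [hz, Units.smul_def, Units.smul_def, smul_eq_mul, smul_eq_mul, reducedNorm_mul_holds ℚ X.B,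
        reducedNorm_mul_holds ℚ X.B, reducedNorm_units_inv, hu₀, hβ₀, hgr, hu]
      field_simp
    have hrnorm : padicNorm p r ≤ 1 := by
      have h := (Padic.norm_ratCast_le_one_iff (p := p)).mpr hr
      rw [Padic.eq_padicNorm] at h
      exact_mod_cast h
    refine ⟨e z, ?_, (p : ℚ) ^ 4 * r / 8, padicNorm_pow_four_mul_div_eight_lt_one hp hrnorm, ?_⟩
    · obtain ⟨c, hc0, hcp, hcz⟩ := hzL
      refine ⟨c, hc0, hcp, ?_⟩
      rw [hΛ, mem_map_ringEquiv_iff, map_zsmul]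
      change (c : ℤ) • e.symm (e z) ∈ L
      rwa [e.symm_apply_apply]
    · rw [QuaternionAlgebra.mul_star_self_eq_algebraMap_reducedNorm ℚ (e z), reducedNorm_algEquiv e z,
        hnz]
      congr 1
      ring
  -- Step 5: a norm-one point of `L`
  obtain ⟨xH, hxΛ, hx1⟩ := QuaternionAlgebra.exists_mem_mul_star_eq_one a b ha hb hdef hΛfull hlocΛ
  set x : X.B := e.symm xH with hx
  have hxL : x ∈ L := (mem_map_ringEquiv_iff e.toRingEquiv).mp hxΛ
  have hnx : reducedNorm ℚ X.B x = 1 := by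
    have h := (QuaternionAlgebra.mul_star_self_eq_one_iff ℚ xH).mp hx1
    rwa [← e.apply_symm_apply xH, reducedNorm_algEquiv e] at h
  -- Step 6: `β = β₀ x ∈ I` with `nrd β = n`
  set β : X.B := β₀ * x with hβ
  have hβI : β ∈ I := by
    have h := hxL
    rw [hL, mem_units_smul_submodule_iff, inv_inv, Units.smul_def, hu₀, smul_eq_mul] at h
    exact h
  have hnβ : reducedNorm ℚ X.B β = n := by
    rw [hβ, reducedNorm_mul_holds ℚ X.B, hβ₀, hnx, mul_one]
  have hβ0 : β ≠ 0 := by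
    intro h
    rw [h, reducedNorm_apply_zero] at hnβ
    exact hnpos.ne hnβ
  set uβ : (X.B)ˣ := (hdiv β hβ0).unit with huβdef
  have huβ : (uβ : X.B) = β := (hdiv β hβ0).unit_spec
  have hβO : β ∈ X.O := hIO hβI
  refine ⟨uβ, by rw [huβ]; exact hβO, by rw [huβ, hnβ]; exact hnpos, ?_⟩
  -- Step 7: `I = β O` by comparing indices
  have hleft : (uβ : X.B) ∈ Brandt.leftOrder X.O := by
    rw [hZO.toIsOrder.leftOrder_eq, huβ]; exact hβO
  have hle1 : uβ • X.O ≤ I := by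
    intro y hy
    rw [mem_units_smul_submodule_iff, Units.smul_def, smul_eq_mul] at hy
    have hyeq : y = β * (((uβ⁻¹ : (X.B)ˣ) : X.B) * y) := by
      rw [← mul_assoc, ← huβ, Units.mul_inv, one_mul]
    rw [hyeq]
    exact hI.mul_mem hβI hy
  have hidx : (uβ • X.O).toAddSubgroup.relIndex X.O.toAddSubgroup = m := by
    have h := Brandt.cast_relIndex_units_smul_eq_reducedNorm_sq hZO.isFullLattice hleft
    rw [huβ, hnβ] at h
    have h' : (((uβ • X.O).toAddSubgroup.relIndex X.O.toAddSubgroup : ℕ) : ℚ) = ((n ^ 2 : ℕ) : ℚ) := by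
      rw [h]; push_cast; ring
    rw [← hn2]
    exact_mod_cast h'
  have hmul := AddSubgroup.relIndex_mul_relIndex (uβ • X.O).toAddSubgroup I.toAddSubgroup
    X.O.toAddSubgroup (Submodule.toAddSubgroup_mono hle1) (Submodule.toAddSubgroup_mono hIO)
  rw [hidx, ← hm] at hmul
  have hr1 : (uβ • X.O).toAddSubgroup.relIndex I.toAddSubgroup = 1 := (mul_eq_right₀ hm0).mp hmul
  have hge : I ≤ uβ • X.O := fun y hy => (AddSubgroup.relIndex_eq_one.mp hr1) hy
  exact le_antisymm hge hle1

end ShimuraCurveData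

end Literature.NumberTheory.Automorphic
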